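import Literature.Dynamics.NBody.JensenLeykin2025
import Literature.Dynamics.NBody.AlbouyKaloshin2012Roberts
import Mathlib.Analysis.SpecialFunctions.Pow.Real
import Mathlib.Data.Set.Finite.Basic
import Mathlib.Tactic
import HarnessLib

/-!
# The Jensen–Leykin / Albouy–Chenciner torus system is positive-dimensional at Roberts' masses

[JensenLeykin2025] state generic finiteness of *normalized central configurations* over the torus
`r ∈ (K^*)^N` (tree file `JensenLeykin2025.lean`: `jlNormalizedCCs K m` = symmetric `r` with
`r_ii = 0`, `r_ij ≠ 0`, all `g_ij = Σ_k m_k S_ik (r_jk² − r_ik² − r_ij²) = 0` with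
`S_ik = r_ik⁻³ − 1`, and all four-body Cayley–Menger determinants zero), and report (§4.2 p. 6)
that their valuation test *fails* on the mass family `(a, a, b, b, c)`.  Here we prove a concrete
reason at one point of that family: at the masses `(1/2, 1/2, 1/2, 1/2, 1/8)` of Roberts' modified
continuum ([AlbouyKaloshin2012, p. 543]; tree file `AlbouyKaloshin2012Roberts.lean`) — equivalently
at `(4, 4, 4, 4, 1)`, since `g_ij` is linear in the masses — the torus variety contains an explicit
real curve, so it is **not** finite over `ℝ` (a fortiori not over `ℂ` or a Puiseux field):

* `r = κ · ρ(t)`, `κ³ = 8/17`, where `ρ(t)` are the *signed* mutual distances of the rhombus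
  `(±a, 0), (0, ±b)` plus the origin, `a = (1 − t²)/(1 + t²)`, `b = 2t/(1 + t²)`: `ρ₀₁ = 2a`,
  `ρ₂₃ = 2b`, `ρ_ij = 1` between the two pairs, and `ρ_k4 = −a, −b` (NEGATIVE — allowed on the torus,
  exactly as the sign of `δ_k5` is relaxed in [AlbouyKaloshin2012, (4)]).
* `cayleyMenger4_eq_zero_of_planar`: a Cayley–Menger determinant built from squared distances of
  planar points vanishes (rank factorisation through a `5 × 4` matrix) — any field.
* `jlNormalizedCCs_smul_masses`: `jlNormalizedCCs K (s • m) = jlNormalizedCCs K m` for `s ≠ 0`.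
* `jlNormalizedCCs_robertsMasses_infinite`, `jlNormalizedCCs_44441_infinite`;
* `jl_exceptionalPoly_vanishes_on_robertsLine` / `_at_44441`: any exceptional polynomial of a
  `jlGenericFiniteness 5`-shaped certificate vanishes on the line `s · (4,4,4,4,1)`.

Consequently no *pointed* tropical prevariety / zero-dimensionality certificate for this system can
exist at the `E₃₂` points `(4s, 4s, s)`, and any "generic on `E₃₂`" finiteness statement over the
torus must exclude them.  Exact-arithmetic cross-checks (two implementations):
pub-smale6 `certs/roberts_continuum/jl_torus_check.py`, `jl_torus_check_sympy.py`.
-/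

namespace Literature.Dynamics.NBody

open Finset

/-- A four-body Cayley–Menger determinant built from the squared mutual distances of *planar*
points `(x i, y i)` vanishes, over any field: the bordered matrix factors through a `5 × 4` matrix.
(The hypothesis only involves `r_ij²`, so signs of `r_ij` are irrelevant.) [folklore] -/
theorem cayleyMenger4_eq_zero_of_planar {K : Type*} [Field K] {n : ℕ} (r : Fin n → Fin n → K)
    (x y : Fin n → K) (h : ∀ i j, r i j ^ 2 = (x i - x j) ^ 2 + (y i - y j) ^ 2)
    (a b c d : Fin n) : cayleyMenger4 r a b c d = 0 := by
  have hM : !![0, 1, 1, 1, 1;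
               1, 0, r a b ^ 2, r a c ^ 2, r a d ^ 2;
               1, r a b ^ 2, 0, r b c ^ 2, r b d ^ 2;
               1, r a c ^ 2, r b c ^ 2, 0, r c d ^ 2;
               1, r a d ^ 2, r b d ^ 2, r c d ^ 2, 0]
      = !![1, 0, 0, 0, 0;
           x a ^ 2 + y a ^ 2, 1, x a, y a, 0;
           x b ^ 2 + y b ^ 2, 1, x b, y b, 0;
           x c ^ 2 + y c ^ 2, 1, x c, y c, 0;
           x d ^ 2 + y d ^ 2, 1, x d, y d, 0] *
        !![0, 1, 1, 1, 1;
           1, x a ^ 2 + y a ^ 2, x b ^ 2 + y b ^ 2, x c ^ 2 + y c ^ 2, x d ^ 2 + y d ^ 2;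
           0, -2 * x a, -2 * x b, -2 * x c, -2 * x d;
           0, -2 * y a, -2 * y b, -2 * y c, -2 * y d;
           (0 : K), 0, 0, 0, 0] := by
    ext i j
    fin_cases i <;> fin_cases j <;> simp [Matrix.mul_apply, Fin.sum_univ_five, h] <;> ring
  unfold cayleyMenger4
  rw [hM, Matrix.det_mul]
  have hz : Matrix.det !![0, 1, 1, 1, 1;
           1, x a ^ 2 + y a ^ 2, x b ^ 2 + y b ^ 2, x c ^ 2 + y c ^ 2, x d ^ 2 + y d ^ 2;
           0, -2 * x a, -2 * x b, -2 * x c, -2 * x d;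
           0, -2 * y a, -2 * y b, -2 * y c, -2 * y d;
           (0 : K), 0, 0, 0, 0] = 0 :=
    Matrix.det_eq_zero_of_row_eq_zero 4 (fun j => by fin_cases j <;> rfl)
  rw [hz, mul_zero]

/-- `g_ij` is linear in the masses. [folklore] -/
theorem jlG_smul_masses {K : Type*} [Field K] {n : ℕ} (s : K) (m : Fin n → K)
    (r : Fin n → Fin n → K) (i j : Fin n) :
    jlG (fun k => s * m k) r i j = s * jlG m r i j := by
  unfold jlG
  rw [Finset.mul_sum]
  refine Finset.sum_congr rfl ?_
  intro k _
  ring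

/-- Mass-scaling invariance of the torus system: the solution set only depends on the mass RATIOS
(the normalisation `S = r⁻³ − 1` has absorbed the multiplier). [cite: JensenLeykin2025, §2.2 p. 2] -/
theorem jlNormalizedCCs_smul_masses {K : Type*} [Field K] {n : ℕ} (s : K) (hs : s ≠ 0)
    (m : Fin n → K) : jlNormalizedCCs K (fun k => s * m k) = jlNormalizedCCs K m := by
  ext r
  simp only [jlNormalizedCCs, Set.mem_setOf_eq, jlG_smul_masses, mul_eq_zero, hs, false_or]

/-- The rational parametrisation of the circle `a² + b² = 1` (first coordinate). [folklore] -/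
noncomputable def jlRobA (t : ℝ) : ℝ := (1 - t ^ 2) / (1 + t ^ 2)
/-- The rational parametrisation of the circle `a² + b² = 1` (second coordinate). [folklore] -/
noncomputable def jlRobB (t : ℝ) : ℝ := 2 * t / (1 + t ^ 2)

/-- `a(t)² + b(t)² = 1`. [folklore] -/
theorem jlRobA_sq_add_jlRobB_sq (t : ℝ) : jlRobA t ^ 2 + jlRobB t ^ 2 = 1 := by
  have h1 : (1 : ℝ) + t ^ 2 ≠ 0 := by positivity
  unfold jlRobA jlRobB
  field_simp
  ring

/-- Signed mutual "distances" of the Roberts rhombus-plus-centre: bodies `0,1 = (±a,0)`,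
`2,3 = (0,±b)`, `4 = (0,0)`; the entries towards body `4` are NEGATIVE.
[cite: AlbouyKaloshin2012, p. 543 ("we change δ_k5 into −δ_k5")] -/
def signedRho (a b : ℝ) : Fin 5 → Fin 5 → ℝ :=
  !![0, 2 * a, 1, 1, -a;
     2 * a, 0, 1, 1, -a;
     1, 1, 0, 2 * b, -b;
     1, 1, 2 * b, 0, -b;
     -a, -a, -b, -b, 0]

/-- The explicit curve in the torus variety: `r = κ · ρ(t)` (`κ³ = 8/17` makes `g = 0`).
[cite: AlbouyKaloshin2012, p. 543; JensenLeykin2025 §2.2 p. 2 — derived in-tree] -/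
noncomputable def jlRobertsR (κ t : ℝ) : Fin 5 → Fin 5 → ℝ :=
  fun i j => κ * signedRho (jlRobA t) (jlRobB t) i j

/-- `A_ij = Σ_{k ≠ i} m_k ρ_ik⁻³ (ρ_jk² − ρ_ik² − ρ_ij²)` (the `r⁻³` part of `g_ij`).
[cite: JensenLeykin2025, §2.2 p. 2] -/
noncomputable def jlApart {n : ℕ} (m : Fin n → ℝ) (ρ : Fin n → Fin n → ℝ) (i j : Fin n) : ℝ :=
  ∑ k, m k * (if i = k then 0 else (ρ i k)⁻¹ ^ 3) * (ρ j k ^ 2 - ρ i k ^ 2 - ρ i j ^ 2)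

/-- `B_ij = Σ_{k ≠ i} m_k (ρ_jk² − ρ_ik² − ρ_ij²)` (the `−1` part of `g_ij`).
[cite: JensenLeykin2025, §2.2 p. 2] -/
noncomputable def jlBpart {n : ℕ} (m : Fin n → ℝ) (ρ : Fin n → Fin n → ℝ) (i j : Fin n) : ℝ :=
  ∑ k, m k * (if i = k then 0 else 1) * (ρ j k ^ 2 - ρ i k ^ 2 - ρ i j ^ 2)

/-- Scaling splits `g_ij(κρ) = κ⁻¹ A_ij(ρ) − κ² B_ij(ρ)`. [folklore] -/
theorem jlG_scale {n : ℕ} (m : Fin n → ℝ) (ρ : Fin n → Fin n → ℝ) (κ : ℝ) (hκ : κ ≠ 0)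
    (i j : Fin n) :
    jlG m (fun k l => κ * ρ k l) i j = κ⁻¹ * jlApart m ρ i j - κ ^ 2 * jlBpart m ρ i j := by
  unfold jlG jlS jlApart jlBpart
  rw [Finset.mul_sum, Finset.mul_sum, ← Finset.sum_sub_distrib]
  refine Finset.sum_congr rfl ?_
  intro k _
  by_cases hik : i = k
  · simp [hik]
  · simp only [hik, if_false, mul_inv]
    field_simp
    try ring

/-- The key identity on the signed Roberts family: `17 A_ij = 8 B_ij` for all `i ≠ j`
(masses `(1/2,1/2,1/2,1/2,1/8)`), i.e. the family solves `g = 0` after scaling by `κ³ = 8/17`.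
[cite: AlbouyKaloshin2012, p. 543 — derived in-tree; cross-check pub-smale6 certs/roberts_continuum/jl_torus_check.py] -/
theorem jlApart_roberts (t : ℝ) (ht : t ≠ 0) (ht' : 1 - t ^ 2 ≠ 0) (i j : Fin 5) (hij : i ≠ j) :
    17 * jlApart robertsMasses (signedRho (jlRobA t) (jlRobB t)) i j
      = 8 * jlBpart robertsMasses (signedRho (jlRobA t) (jlRobB t)) i j := by
  have h1 : (1 : ℝ) + t ^ 2 ≠ 0 := by positivity
  fin_cases i <;> fin_cases j <;> simp at hij <;>
    simp [jlApart, jlBpart, Fin.sum_univ_five, signedRho, jlRobA, jlRobB, robertsMasses] <;>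
    field_simp <;> ring

/-- The squared entries of the family are the squared distances of the planar points
`κ(±a,0), κ(0,±b), (0,0)` (so every Cayley–Menger determinant vanishes). [folklore] -/
theorem jlRobertsR_sq (κ t : ℝ) (i j : Fin 5) :
    jlRobertsR κ t i j ^ 2 =
      ((fun k => κ * ![jlRobA t, -jlRobA t, 0, 0, 0] k) i
        - (fun k => κ * ![jlRobA t, -jlRobA t, 0, 0, 0] k) j) ^ 2 +
      ((fun k => κ * ![0, 0, jlRobB t, -jlRobB t, 0] k) i
        - (fun k => κ * ![0, 0, jlRobB t, -jlRobB t, 0] k) j) ^ 2 := by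
  have hab := jlRobA_sq_add_jlRobB_sq t
  fin_cases i <;> fin_cases j <;> simp [jlRobertsR, signedRho] <;>
    first
    | ring1
    | linear_combination (κ ^ 2) * hab
    | linear_combination (-κ ^ 2) * hab

/-- MEMBERSHIP: for `κ³ = 8/17` and `t > 1` the point `κ · ρ(t)` is a normalized central
configuration of the torus system for the masses `(1/2,1/2,1/2,1/2,1/8)`.
[cite: AlbouyKaloshin2012, p. 543; JensenLeykin2025 §2.2–2.3 p. 2 — derived in-tree] -/
theorem jlRobertsR_mem (κ t : ℝ) (hκ : κ ^ 3 = 8 / 17) (ht : 1 < t) :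
    jlRobertsR κ t ∈ jlNormalizedCCs ℝ robertsMasses := by
  have hκ0 : κ ≠ 0 := by rintro rfl; norm_num at hκ
  have ht0 : t ≠ 0 := by positivity
  have ht' : 1 - t ^ 2 ≠ 0 := by nlinarith
  have h1 : (1 : ℝ) + t ^ 2 ≠ 0 := by positivity
  have hA : jlRobA t ≠ 0 := by unfold jlRobA; exact div_ne_zero ht' h1
  have hB : jlRobB t ≠ 0 := by unfold jlRobB; positivity
  refine ⟨⟨?_, ?_, ?_⟩, ?_, ?_⟩
  · intro i j; fin_cases i <;> fin_cases j <;> simp [jlRobertsR, signedRho]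
  · intro i; fin_cases i <;> simp [jlRobertsR, signedRho]
  · intro i j hij
    fin_cases i <;> fin_cases j <;> simp at hij <;> simp [jlRobertsR, signedRho, hκ0, hA, hB]
  · intro i j hij
    have hs := jlG_scale robertsMasses (signedRho (jlRobA t) (jlRobB t)) κ hκ0 i j
    have hkey := jlApart_roberts t ht0 ht' i j hij
    show jlG robertsMasses (jlRobertsR κ t) i j = 0
    have : jlRobertsR κ t = fun k l => κ * signedRho (jlRobA t) (jlRobB t) k l := rfl
    rw [this, hs]
    set A := jlApart robertsMasses (signedRho (jlRobA t) (jlRobB t)) i j with hAdef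
    set B := jlBpart robertsMasses (signedRho (jlRobA t) (jlRobB t)) i j with hBdef
    have hB' : B = 17 / 8 * A := by linear_combination (-1 / 8 : ℝ) * hkey
    rw [hB']
    have hκ3 : κ ^ 2 * (17 / 8 * A) = κ⁻¹ * (κ ^ 3 * (17 / 8) * A) := by field_simp
    rw [hκ3, hκ]
    ring
  · intro a b c d _ _ _ _ _ _
    exact cayleyMenger4_eq_zero_of_planar _ _ _ (jlRobertsR_sq κ t) a b c d

/-- A real cube root of `8/17`. [folklore] -/
theorem exists_kappa : ∃ κ : ℝ, κ ^ 3 = 8 / 17 :=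
  ⟨(8 / 17 : ℝ) ^ ((3 : ℕ)⁻¹ : ℝ), by
    rw [Real.rpow_inv_natCast_pow (by norm_num) (by norm_num)]⟩

/-- The family is injective in `t > 1` (entry `(0,1)` is `2κ(1 − t²)/(1 + t²)`). [folklore] -/
theorem jlRobertsR_injOn (κ : ℝ) (hκ0 : κ ≠ 0) : Set.InjOn (jlRobertsR κ) (Set.Ioi 1) := by
  intro t₁ h₁ t₂ h₂ h
  simp only [Set.mem_Ioi] at h₁ h₂
  have e := congrFun (congrFun h 0) 1
  simp [jlRobertsR, signedRho, jlRobA, hκ0] at e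
  have p1 : (1 : ℝ) + t₁ ^ 2 ≠ 0 := by positivity
  have p2 : (1 : ℝ) + t₂ ^ 2 ≠ 0 := by positivity
  rw [div_eq_div_iff p1 p2] at e
  have hsq : (t₁ - t₂) * (t₁ + t₂) = 0 := by nlinarith [e]
  rcases mul_eq_zero.mp hsq with h0 | h0
  · linarith
  · linarith

/-- MAIN: the torus system of [JensenLeykin2025] has infinitely many real solutions at the masses
`(1/2, 1/2, 1/2, 1/2, 1/8)`.
[cite: JensenLeykin2025, §4.2 p. 6 ("(a,a,b,b,c) fails"); derived in-tree from AlbouyKaloshin2012 p. 543] -/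
theorem jlNormalizedCCs_robertsMasses_infinite : (jlNormalizedCCs ℝ robertsMasses).Infinite := by
  obtain ⟨κ, hκ⟩ := exists_kappa
  have hκ0 : κ ≠ 0 := by rintro rfl; norm_num at hκ
  have hsub : jlRobertsR κ '' Set.Ioi 1 ⊆ jlNormalizedCCs ℝ robertsMasses := by
    rintro _ ⟨t, ht, rfl⟩
    exact jlRobertsR_mem κ t hκ ht
  exact ((Set.Ioi_infinite (1 : ℝ)).image (jlRobertsR_injOn κ hκ0)).mono hsub

/-- … and hence at the positive integer masses `(4, 4, 4, 4, 1) = 8 • (1/2,1/2,1/2,1/2,1/8)`,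
a point of Albouy–Kaloshin's component `E₃₂ = {m₁ = m₂, m₃ = m₄}`.
[cite: JensenLeykin2025, §4.2 p. 6; AlbouyKaloshin2012, (32) p. 576 and p. 543] -/
theorem jlNormalizedCCs_44441_infinite : (jlNormalizedCCs ℝ ![4, 4, 4, 4, 1]).Infinite := by
  have h : (![4, 4, 4, 4, 1] : Fin 5 → ℝ) = fun k => (8 : ℝ) * robertsMasses k := by
    funext k; fin_cases k <;> simp [robertsMasses] <;> norm_num
  rw [h, jlNormalizedCCs_smul_masses (8 : ℝ) (by norm_num)]
  exact jlNormalizedCCs_robertsMasses_infinite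

/-- CONSEQUENCE for generic-finiteness statements over the torus (the shape of
`jlGenericFiniteness 5`): every exceptional polynomial `P ∈ ℚ[m₁,…,m₅]` off whose zero set the
torus system is finite over all fields of characteristic `0` must vanish at `s · (4,4,4,4,1)` for
every real `s ≠ 0` — the `E₃₂` line through Roberts' masses lies in the exceptional locus of ANY
such certificate. [cite: JensenLeykin2025, §2.4 p. 3 and §4.2 p. 6 — derived in-tree] -/
theorem jl_exceptionalPoly_vanishes_on_robertsLine (P : MvPolynomial (Fin 5) ℚ)
    (hP : ∀ (K : Type) [Field K] [CharZero K] (m : Fin 5 → K),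
      MvPolynomial.aeval m P ≠ 0 → (jlNormalizedCCs K m).Finite)
    (s : ℝ) (hs : s ≠ 0) :
    MvPolynomial.aeval (fun k => s * (![4, 4, 4, 4, 1] : Fin 5 → ℝ) k) P = 0 := by
  by_contra h
  have hfin := hP ℝ _ h
  rw [jlNormalizedCCs_smul_masses s hs] at hfin
  exact jlNormalizedCCs_44441_infinite hfin

/-- In particular at the integer point `(4,4,4,4,1)` itself.
[cite: JensenLeykin2025, §2.4 p. 3 — derived in-tree] -/
theorem jl_exceptionalPoly_vanishes_at_44441 (P : MvPolynomial (Fin 5) ℚ)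
    (hP : ∀ (K : Type) [Field K] [CharZero K] (m : Fin 5 → K),
      MvPolynomial.aeval m P ≠ 0 → (jlNormalizedCCs K m).Finite) :
    MvPolynomial.aeval (![4, 4, 4, 4, 1] : Fin 5 → ℝ) P = 0 := by
  have h := jl_exceptionalPoly_vanishes_on_robertsLine P hP 1 one_ne_zero
  simpa using h

end Literature.Dynamics.NBody
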